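import Mathlib
import Summits.CriticalPhenomena.PercolationContinuityZ3.Theorems.PercNearOneGluingNoHeavyLowerTailHexMSMatchReservedTerms

/-!
# The kernel method: antichains have no essential differences (hp-7 gen 77)

Support file for crux `stmt-CriticalPhenomena-4575` (route `PercNearOneGluingNoHeavy`), hull-port seat `prim-hp-7` (generation 77);
`--supports stmt-CriticalPhenomena-4575`.  No `sorry`.  Memo: `run/shared/lean/prim/prim-hp-7/FROM-prim-hp-7-g77-INTERVAL-GAME.md` §0 (D), §2.

The certificate files (`…IntervalCertificates`, `…HexMSMatchReservedTerms`, `…HexMSMatchIntervalGame`) bound `#F + #Θ ≤ #T` by exhibiting functionals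
(the PRIMAL side).  This file records the DUAL side ('kernel method'): if a vector `w` on the members is orthogonal to the containment columns of all
unreserved differences, then the standard Möbius functional of a member `g` evaluates `w` to `∑_{f ⊆ g} w f` on one hand and, on the other hand, to a
sum over the RESERVED differences disjoint from `g` only.  For an antichain the first quantity is `w g` itself, which makes the kernel explicit.

* `Kernel.linearIndependent_of_antichain` — **Theorem A.**  Let `F` be an antichain and `D` a family of sets such that every member of `F` either meets
  every element of `D` or contains no element of `D`.  Then the containment vectors of the members restricted to the columns `(F \\ F) \ D` are linearly
  independent over `ℚ`.  (Members meeting all of `D` see no reserved column, so their coefficient vanishes; a member containing a reserved `d` meets it, so the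
  up-sums over reserved columns vanish too; then every coefficient vanishes.)
* `Kernel.card_add_card_le_card_diffs_of_antichain` — hence `#F + #D ≤ #(F \\ F)` when `D ⊆ F \\ F` (via
  `ReservedTerms.card_add_card_le_card_of_linearIndependent`).  For the one-type derived instances of the (MATCH*) programme (designated `d₅` meeting every
  `p ∈ P` and contained in no `q ∈ Q`, memo §0 (E)) this is (MS2) inside `F \\ F`, a second proof of gen 76's block-order theorem for antichains.
* `Kernel.linearIndependent_sdiff_singleton_of_antichain` — **an antichain has no essential difference**: every single nonempty difference can be deleted
  from `F \\ F` keeping the containment vectors independent (the containment matroid on `F \\ F` has no coloop except possibly `∅`).  Numerically (memo, e27):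
  518 random intersecting antichains, 0 coloops; in general every coloop lies inside a containment difference `f \ h`, `h ⊊ f`.
-/

namespace Summit.CriticalPhenomena.PercolationContinuityZ3.Theorems

namespace Kernel

open Finset
open scoped FinsetFamily

variable {α : Type*} [DecidableEq α]

/-- **Theorem A (kernel method for antichains)** (hp-7 gen 77).  If `F` is an antichain and every member of `F` either meets every set of `D` or contains
no set of `D`, then the containment vectors `E ↦ [E ⊆ f]` of the members, restricted to the differences outside `D`, are linearly independent. -/
theorem linearIndependent_of_antichain (F D : Finset (Finset α))
    (hanti : ∀ f ∈ F, ∀ g ∈ F, f ⊆ g → f = g)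
    (hdich : ∀ g ∈ F, (∀ d ∈ D, ¬ Disjoint d g) ∨ (∀ d ∈ D, ¬ d ⊆ g)) :
    LinearIndependent ℚ
      (fun (f : ↥F) (E : ↥((F \\ F) \ D)) => if (E : Finset α) ⊆ (f : Finset α) then (1 : ℚ) else 0) := by
  classical
  rw [Fintype.linearIndependent_iff]
  intro w hw
  set Δ : Finset (Finset α) := F \\ F with hΔ
  -- up-sums of `w`
  let W : Finset α → ℚ := fun E => ∑ f : ↥F, w f * (if E ⊆ (f : Finset α) then 1 else 0)
  have hWK : ∀ E ∈ Δ \ D, W E = 0 := by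
    intro E hE
    have h := congr_fun hw ⟨E, hE⟩
    simp only [Finset.sum_apply, Pi.smul_apply, smul_eq_mul, Pi.zero_apply] at h
    exact h
  -- Möbius weights of `(Δ, ⊆)` based at `∅`
  obtain ⟨μ, hμ⟩ := IntervalCertificate.exists_moebius_weights_from Δ ∅
  -- (a) the standard functional of `g`, applied to the up-sums, returns `w g`
  have key : ∀ g : ↥F, ∑ E ∈ Δ.filter (fun E => Disjoint E (g : Finset α)), μ E * W E = w g := by
    intro g
    have step1 : ∑ E ∈ Δ.filter (fun E => Disjoint E (g : Finset α)), μ E * W E =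
        ∑ f : ↥F, w f * ∑ E ∈ Δ.filter (fun E => Disjoint E (g : Finset α)),
          μ E * (if E ⊆ (f : Finset α) then 1 else 0) := by
      simp only [W, Finset.mul_sum]
      rw [Finset.sum_comm]
      refine Finset.sum_congr rfl fun f _ => Finset.sum_congr rfl fun E _ => ?_
      ring
    have step2 : ∀ f : ↥F, ∑ E ∈ Δ.filter (fun E => Disjoint E (g : Finset α)),
        μ E * (if E ⊆ (f : Finset α) then 1 else 0) = if f = g then 1 else 0 := by
      intro f
      have hfg : (f : Finset α) \ (g : Finset α) ∈ Δ := sdiff_mem_diffs f.2 g.2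
      have e1 : ∑ E ∈ Δ.filter (fun E => Disjoint E (g : Finset α)), μ E * (if E ⊆ (f : Finset α) then 1 else 0) =
          ∑ E ∈ Δ.filter (fun E => ∅ ⊆ E ∧ E ⊆ (f : Finset α) \ (g : Finset α)), μ E := by
        rw [Finset.sum_filter, Finset.sum_filter]
        refine Finset.sum_congr rfl fun E _ => ?_
        by_cases h1 : Disjoint E (g : Finset α)
        · by_cases h2 : E ⊆ (f : Finset α)
          · have h3 : ∅ ⊆ E ∧ E ⊆ (f : Finset α) \ (g : Finset α) := ⟨empty_subset E, subset_sdiff.mpr ⟨h2, h1⟩⟩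
            rw [if_pos h1, if_pos h2, if_pos h3, mul_one]
          · have h3 : ¬ (∅ ⊆ E ∧ E ⊆ (f : Finset α) \ (g : Finset α)) := fun h => h2 (subset_sdiff.mp h.2).1
            rw [if_pos h1, if_neg h2, if_neg h3, mul_zero]
        · have h3 : ¬ (∅ ⊆ E ∧ E ⊆ (f : Finset α) \ (g : Finset α)) := fun h => h1 (subset_sdiff.mp h.2).2
          rw [if_neg h1, if_neg h3]
      rw [e1, hμ _ hfg]
      have e2 : ((f : Finset α) \ (g : Finset α) = ∅) ↔ f = g := by
        rw [sdiff_eq_empty_iff_subset]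
        constructor
        · intro h
          exact Subtype.ext (hanti _ f.2 _ g.2 h)
        · rintro rfl
          exact subset_rfl
      by_cases h : f = g
      · rw [if_pos (e2.mpr h), if_pos h]
      · rw [if_neg (fun h' => h (e2.mp h')), if_neg h]
    rw [step1]
    simp_rw [step2]
    simp
  -- (b) members meeting every set of `D` have coefficient zero
  have hmeet : ∀ g : ↥F, (∀ d ∈ D, ¬ Disjoint d (g : Finset α)) → w g = 0 := by
    intro g hg
    rw [← key g]
    refine Finset.sum_eq_zero fun E hE => ?_
    obtain ⟨hEΔ, hEg⟩ := mem_filter.mp hE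
    by_cases hED : E ∈ D
    · exact absurd hEg (hg E hED)
    · rw [hWK E (mem_sdiff.mpr ⟨hEΔ, hED⟩), mul_zero]
  -- (c) hence every up-sum over a set of `D` vanishes: a member containing `d ∈ D` is of the first kind
  have hWD : ∀ E ∈ D, W E = 0 := by
    intro E hED
    refine Finset.sum_eq_zero fun f _ => ?_
    by_cases hEf : E ⊆ (f : Finset α)
    · rcases hdich _ f.2 with h1 | h2
      · rw [hmeet f h1, zero_mul]
      · exact absurd hEf (h2 E hED)
    · rw [if_neg hEf, mul_zero]
  -- (d) so all up-sums over differences vanish, and with (a) every coefficient vanishes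
  have hWΔ : ∀ E ∈ Δ, W E = 0 := by
    intro E hE
    by_cases hED : E ∈ D
    · exact hWD E hED
    · exact hWK E (mem_sdiff.mpr ⟨hE, hED⟩)
  intro g
  rw [← key g]
  refine Finset.sum_eq_zero fun E hE => ?_
  rw [hWΔ E (mem_filter.mp hE).1, mul_zero]

/-- **`#F + #D ≤ #(F \\ F)` for antichains** (hp-7 gen 77): if `F` is an antichain, `D ⊆ F \\ F`, and every member of `F` meets every set of `D` or contains
none of them, then the differences outside `D` already number at least `#F`. -/
theorem card_add_card_le_card_diffs_of_antichain (F D : Finset (Finset α))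
    (hanti : ∀ f ∈ F, ∀ g ∈ F, f ⊆ g → f = g) (hD : D ⊆ F \\ F)
    (hdich : ∀ g ∈ F, (∀ d ∈ D, ¬ Disjoint d g) ∨ (∀ d ∈ D, ¬ d ⊆ g)) :
    #F + #D ≤ #(F \\ F) :=
  ReservedTerms.card_add_card_le_card_of_linearIndependent F (F \\ F) D hD
    (linearIndependent_of_antichain F D hanti hdich)

/-- **An antichain has no essential difference** (hp-7 gen 77): for an antichain `F` and any nonempty set `E`, the containment vectors of the members
restricted to `(F \\ F) \ {E}` are still linearly independent — no single nonempty column of the containment matrix on `F \\ F` is a coloop. -/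
theorem linearIndependent_sdiff_singleton_of_antichain (F : Finset (Finset α)) (E : Finset α)
    (hanti : ∀ f ∈ F, ∀ g ∈ F, f ⊆ g → f = g) (hE : E ≠ ∅) :
    LinearIndependent ℚ
      (fun (f : ↥F) (E' : ↥((F \\ F) \ {E})) => if (E' : Finset α) ⊆ (f : Finset α) then (1 : ℚ) else 0) := by
  refine linearIndependent_of_antichain F {E} hanti ?_
  intro g _
  by_cases h : Disjoint E g
  · right
    intro d hd
    rw [mem_singleton] at hd
    subst hd
    intro hsub
    exact hE (h.eq_bot_of_le hsub)
  · left
    intro d hd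
    rw [mem_singleton] at hd
    subst hd
    exact h

end Kernel

end Summit.CriticalPhenomena.PercolationContinuityZ3.Theorems
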